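import Summits.AtomisticToContinuum.HydrodynamicLimit.Theorems.CollisionIsometryCLTCollisionalTransferLocalityTimeDerivBounds
import HarnessLib

/-!
# Joint continuity of the space derivatives of smooth space–time tests on `[0, t] × 𝕋³`

Helper file (`--supports stmt-AtomisticToContinuum-9518`, line `hemisphere-affine-slaving`, skeleton
v10.1) for the crux `CollisionalTransferLocality`: the registered stub of the equilibrium rung on the
space partial derivatives `∂_b u(s, ·) = Torus.partialDeriv b (u s)` (`b : Fin 3`) of the time slices of
a test `u : ℝ → 𝕋³ → F` that is jointly smooth on `[0, t] × 𝕋³` (`Torus.IsSmoothSpaceTimeOn (Icc 0 t) u`,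
i.e. the space–time lift `(s, y) ↦ u s (proj y)` is `C^∞` on `[0, t] × ℝ³`), `0 < t`:

* `continuousOn_partialDeriv_slice_Icc` : `(s, x) ↦ ∂_b u(s, x)` is continuous on `[0, t] × 𝕋³`
  (measurability of the time integrand of the rung's gradient functional through a `projIcc`
  extension, and continuity of its slices; applied to the coordinates `fun s y => ψ s y a` of the
  crux's tests).

This is the space analogue of `continuousOn_timeDerivWithin_Icc`
(`CollisionIsometryCLTCollisionalTransferLocalityTimeDerivBounds`), and the proof is the same descent.
For `s ∈ [0, t]` the slice `u s` is smooth (`Torus.IsSmoothSpaceTimeOn.isSmooth_slice`), so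
`∂_b (u s)(proj y) = D(lift (u s))(y) e_b` (`Torus.partialDeriv_eq_fderiv_apply`, `Torus.fderiv_lift`),
and the global lift `lift (u s) = stLift u ∘ (y ↦ (s, y))` has at `y` the Fréchet derivative
`D(stLift u)|_{[0,t] × ℝ³}(s, y) ∘ inr` (chain rule within the product set along the unconstrained
factor, `HasFDerivWithinAt.comp` with `hasFDerivAt_prodMk_right`; `[0, t] × ℝ³` has unique
differentiability for `0 < t`). Hence on `[0, t] × ℝ³` the lift of `∂_b u` is the value
`z ↦ D(stLift u)|_{[0,t] × ℝ³}(z)(0, e_b)` of the within-derivative of the lift of `u`, which is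
continuous there (`ContDiffOn.continuousOn_fderivWithin`), and continuity descends from `[0, t] × ℝ³`
to `[0, t] × 𝕋³` along the open quotient map `id × proj`
(`Literature.Analysis.FluidPDE.Torus.continuousOn_uncurry_of_continuousOn_stLift`). Folklore; nothing
is cited.
-/

namespace Summit.AtomisticToContinuum.HydrodynamicLimit.Theorems.HemisphereAffineSlaving

open scoped BigOperators Topology Classical ENNReal InnerProductSpace
open Filter Set Function MeasureTheory

noncomputable section

open Literature.MathematicalPhysics.KineticTheory (T3 V3)
open Literature.Analysis.FunctionSpaces

namespace SpaceDerivContinuity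

/-! ## The lift of the space partial derivatives of the slices -/

variable {F : Type*} [NormedAddCommGroup F] [NormedSpace ℝ F] {t : ℝ} {u : ℝ → T3 → F}

/-- For `s` in the time set `S`, the global lift `y ↦ u s (proj y)` of the slice `u s` of a jointly
smooth field has at every `y ∈ ℝ³` the Fréchet derivative `D(stLift u)|_{S × ℝ³}(s, y) ∘ inr`, the
spatial part of the within-derivative of the space–time lift (chain rule along `y ↦ (s, y)`, which maps
`ℝ³` into `S × ℝ³`). [folklore] -/
theorem hasFDerivAt_lift_slice {S : Set ℝ} (hu : Torus.IsSmoothSpaceTimeOn S u) {s : ℝ} (hs : s ∈ S)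
    (y : V3) :
    HasFDerivAt (Torus.lift (u s))
      ((fderivWithin ℝ (Torus.stLift u) (S ×ˢ univ) (s, y)).comp (ContinuousLinearMap.inr ℝ ℝ V3)) y := by
  have h1 : HasFDerivWithinAt (Torus.stLift u) (fderivWithin ℝ (Torus.stLift u) (S ×ˢ univ) (s, y))
      (S ×ˢ univ) (s, y) :=
    (hu.differentiableOn (by simp) (s, y) (mk_mem_prod hs (mem_univ _))).hasFDerivWithinAt
  have h2 : HasFDerivWithinAt (fun y' : V3 => ((s, y') : ℝ × V3)) (ContinuousLinearMap.inr ℝ ℝ V3)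
      univ y :=
    (hasFDerivAt_prodMk_right s y).hasFDerivWithinAt
  exact (h1.comp y h2 fun y' _ => mk_mem_prod hs (mem_univ y')).hasFDerivAt_of_univ

/-- For `s` in a time set `S` and `y ∈ ℝ³`, the space partial derivative of the (smooth) slice `u s`
at `proj y` is the within-derivative of the space–time lift along the space direction `(0, e_b)`:
`∂_b (u s)(proj y) = D(stLift u)|_{S × ℝ³}(s, y)(0, e_b)`. [folklore] -/
theorem partialDeriv_slice_apply_proj {S : Set ℝ} (hu : Torus.IsSmoothSpaceTimeOn S u) {s : ℝ}
    (hs : s ∈ S) (b : Fin 3) (y : V3) :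
    Torus.partialDeriv b (u s) (Torus.proj y) =
      fderivWithin ℝ (Torus.stLift u) (S ×ˢ univ) (s, y) ((0 : ℝ), EuclideanSpace.single b (1 : ℝ)) := by
  rw [Torus.partialDeriv_eq_fderiv_apply ((hu.isSmooth_slice hs).isContDiff (by simp)) b,
    ← Torus.fderiv_lift, (hasFDerivAt_lift_slice hu hs y).fderiv, ContinuousLinearMap.comp_apply,
    ContinuousLinearMap.inr_apply]

/-- On `[0, t] × ℝ³`, `0 < t`, the directional Fréchet derivative
`z ↦ D(stLift u)|_{[0,t] × ℝ³}(z)(0, e_b)` of the lift of a jointly smooth field is continuous. [folklore] -/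
theorem continuousOn_fderivWithin_stLift_apply_space (ht : 0 < t)
    (hu : Torus.IsSmoothSpaceTimeOn (Icc 0 t) u) (b : Fin 3) :
    ContinuousOn (fun z : ℝ × V3 =>
        fderivWithin ℝ (Torus.stLift u) (Icc 0 t ×ˢ univ) z ((0 : ℝ), EuclideanSpace.single b (1 : ℝ)))
      (Icc 0 t ×ˢ univ) := by
  have hU : UniqueDiffOn ℝ (Icc 0 t ×ˢ (univ : Set V3)) := (uniqueDiffOn_Icc ht).prod uniqueDiffOn_univ
  exact (hu.continuousOn_fderivWithin hU (by simp)).clm_apply continuousOn_const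

/-- On `[0, t] × ℝ³` the lift of `∂_b u` is the directional Fréchet derivative of the lift of `u` along
`(0, e_b)` (no unique differentiability of the time set is needed: the direction is spatial). [folklore] -/
theorem stLift_partialDeriv_eqOn (hu : Torus.IsSmoothSpaceTimeOn (Icc 0 t) u) (b : Fin 3) :
    EqOn (Torus.stLift (fun s => Torus.partialDeriv b (u s)))
      (fun z : ℝ × V3 =>
        fderivWithin ℝ (Torus.stLift u) (Icc 0 t ×ˢ univ) z ((0 : ℝ), EuclideanSpace.single b (1 : ℝ)))
      (Icc 0 t ×ˢ univ) :=
  fun p hp => partialDeriv_slice_apply_proj hu hp.1 b p.2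

/-- The lift of `∂_b u` is continuous on `[0, t] × ℝ³`. [folklore] -/
theorem continuousOn_stLift_partialDeriv (ht : 0 < t) (hu : Torus.IsSmoothSpaceTimeOn (Icc 0 t) u)
    (b : Fin 3) :
    ContinuousOn (Torus.stLift (fun s => Torus.partialDeriv b (u s))) (Icc 0 t ×ˢ univ) :=
  (continuousOn_fderivWithin_stLift_apply_space ht hu b).congr (stLift_partialDeriv_eqOn hu b)

end SpaceDerivContinuity

/-- Registered stub `continuousOn_partialDeriv_slice_Icc` (equilibrium rung of the line
`hemisphere-affine-slaving`): the space partial derivatives `(s, x) ↦ ∂_b u(s, x)`, `b : Fin 3`, of a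
test jointly smooth on `[0, t] × 𝕋³`, `0 < t`, are continuous on `[0, t] × 𝕋³`. [folklore] -/
theorem continuousOn_partialDeriv_slice_Icc : ∀ {F : Type} [NormedAddCommGroup F] [NormedSpace ℝ F] {t : ℝ} {u : ℝ → T3 → F}, 0 < t → Literature.Analysis.FunctionSpaces.Torus.IsSmoothSpaceTimeOn (Icc 0 t) u → ∀ b : Fin 3, ContinuousOn (fun p : ℝ × T3 => Literature.Analysis.FunctionSpaces.Torus.partialDeriv b (u p.1) p.2) (Icc 0 t ×ˢ univ) := by
  intro F _ _ t u ht hu b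
  exact Literature.Analysis.FluidPDE.Torus.continuousOn_uncurry_of_continuousOn_stLift
    (u := fun s => Torus.partialDeriv b (u s))
    (SpaceDerivContinuity.continuousOn_stLift_partialDeriv ht hu b)

end

end Summit.AtomisticToContinuum.HydrodynamicLimit.Theorems.HemisphereAffineSlaving
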